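import Mathlib
import HarnessLib

/-!
# Radial ("polar") fields of bilinear forms on an inner product space

Topic `Geometry/Riemannian`; support file of the programme towards the named fact
`Weinstein1968_exists_metric_two_le_multiplicity_of_mem_cutLocus` (`WeinsteinCutLocus.lean`).
Weinstein's construction (step (3) of the proof, zbMATH 0159.23902: "the metric is modified inside
`D` only, so that `exp_p` becomes a diffeomorphism of the unit ball onto `D`") produces the new
metric inside the disk in POLAR FORM `dr² + h_r`. The interface `RadialIsometryExp.lean` /
`WeinsteinCriterion.lean` consumes exactly the two Gauss-lemma identities of such a metric read
in Cartesian coordinates on the tangent space. This file provides the Cartesian description of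
polar-form metrics on a real inner product space `V`, with no reference to spheres or polar
coordinates: for a field `K : V → (V →L V →L ℝ)` of bilinear forms ("the tangential part") put

  `polarBilin K v (a, b) = ⟪a, v⟫ ⟪b, v⟫ / ‖v‖² + K v (P_v a, P_v b)`,
  `P_v a = a - (⟪a, v⟫ / ‖v‖²) v`                    (`radialProj v`)

(the orthogonal projection onto `v^⊥`; at `v = 0` the conventions `0⁻¹ = 0`, `P_0 = id` give
`polarBilin K 0 = K 0`). Then (all proved):

* `polarBilin_apply_self_self`, `polarBilin_apply_self_of_inner_eq_zero`,
  `polarBilin_apply_of_inner_eq_zero_self` — **the Gauss identities**: `polarBilin K v (v, v) = ‖v‖²`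
  and `polarBilin K v (v, β) = polarBilin K v (β, v) = 0` for `β ⊥ v` (`v ≠ 0`) — radial lines are
  unit-speed and orthogonal to spheres, whatever `K` is;
* `polarBilin_symm`, `polarBilin_pos` — symmetry, and positive definiteness as soon as `K v` is
  positive definite;
* `polarBilin_eq_of_isRadialAt` — if a form `B` is itself radial at `v` (`B(v,v) = ‖v‖²`,
  `B(v, β) = B(β, v) = 0` for `β ⊥ v`) then `polarBilin (fun _ ↦ B) v = B`: replacing the tangential
  part of a radial form by itself changes nothing — the gluing mechanism of the construction (where
  the pulled-back ambient metric is already radial, the polar field agrees with it);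
* `polarBilin_const_innerSL` — with `K v = ⟪·,·⟫` the polar field is the inner product itself
  (at every `v`, including `0`): near the centre the construction is flat;
* `contDiffOn_radialProj_apply`, `contDiffOn_polarBilin` — smoothness away from `0` (and everywhere
  if `K` is the inner product near `0`, `contDiff_polarBilin_of_eventuallyEq`); `V` finite-dimensional.

The two definitions (`radialProj`, `polarBilin`) are plain abbreviations of explicit formulas;
no named facts are introduced (D-0026).

## References

* A. Weinstein, Ann. of Math. 87 (1968) 29–41, step (3) of the proof of the main theorem
  [Weinstein1968]; zbMATH Zbl 0159.23902.
* J. M. Lee, *Introduction to Riemannian Manifolds*, 2nd ed. (2018), Thm. 6.9 and Cor. 6.10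
  (the Gauss lemma: in normal/polar coordinates `g = dr² + h_r`) [LeeRiemannianManifolds2018].
-/

noncomputable section

open Set Filter Function
open scoped Topology ContDiff RealInnerProductSpace

namespace Literature.Geometry.Riemannian

variable {V : Type*} [NormedAddCommGroup V] [InnerProductSpace ℝ V]

/-- **The orthogonal projection onto `v^⊥`, as an explicit continuous linear map**:
`P_v a = a - (⟪a, v⟫ / ‖v‖²) v` (`P_0 = id` by the convention `0⁻¹ = 0`). [folklore] -/
def radialProj (v : V) : V →L[ℝ] V :=
  ContinuousLinearMap.id ℝ V - (‖v‖ ^ 2)⁻¹ • (innerSL ℝ v).smulRight v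

/-- **The polar field of bilinear forms with tangential part `K`**:
`polarBilin K v (a, b) = ⟪a, v⟫ ⟪b, v⟫ / ‖v‖² + K v (P_v a, P_v b)` — the Cartesian form of a metric
`dr² + h_r` whose restriction to the spheres is prescribed by `K` (Lee 2018, Cor. 6.10 read
backwards). [cite: LeeRiemannianManifolds2018, Thm. 6.9 and Cor. 6.10] -/
def polarBilin (K : V → V →L[ℝ] V →L[ℝ] ℝ) (v : V) : V →L[ℝ] V →L[ℝ] ℝ :=
  (‖v‖ ^ 2)⁻¹ • (ContinuousLinearMap.mul ℝ ℝ).bilinearComp (innerSL ℝ v) (innerSL ℝ v) +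
    (K v).bilinearComp (radialProj v) (radialProj v)

/-! ### Pointwise formulas -/

/-- Unfolding of `radialProj`: `P_v a = a - (⟪v, a⟫ / ‖v‖²) v`. [folklore] -/
@[simp] theorem radialProj_apply (v a : V) :
    radialProj v a = a - ((‖v‖ ^ 2)⁻¹ * ⟪v, a⟫) • v := by
  simp [radialProj, ContinuousLinearMap.smulRight_apply, innerSL_apply_apply, smul_smul]

/-- Unfolding of `polarBilin`: `polarBilin K v (a, b) = ⟪v,a⟫ ⟪v,b⟫ / ‖v‖² + K v (P_v a, P_v b)`.
[folklore] -/
theorem polarBilin_apply (K : V → V →L[ℝ] V →L[ℝ] ℝ) (v a b : V) :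
    polarBilin K v a b = (‖v‖ ^ 2)⁻¹ * (⟪v, a⟫ * ⟪v, b⟫) + K v (radialProj v a) (radialProj v b) := by
  simp [polarBilin, ContinuousLinearMap.bilinearComp_apply, innerSL_apply_apply]

/-- `P_v v = 0` for `v ≠ 0`. [folklore] -/
theorem radialProj_apply_self {v : V} (hv : v ≠ 0) : radialProj v v = 0 := by
  rw [radialProj_apply, real_inner_self_eq_norm_sq]
  have h : ‖v‖ ^ 2 ≠ 0 := pow_ne_zero 2 (norm_ne_zero_iff.2 hv)
  rw [inv_mul_cancel₀ h, one_smul, sub_self]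

/-- `P_v β = β` for `β ⊥ v`. [folklore] -/
theorem radialProj_apply_of_inner_eq_zero {v β : V} (h : ⟪v, β⟫ = 0) : radialProj v β = β := by
  rw [radialProj_apply, h, mul_zero, zero_smul, sub_zero]

/-- `P_v a ⊥ v`. [folklore] -/
theorem inner_radialProj (v a : V) : ⟪v, radialProj v a⟫ = 0 := by
  rw [radialProj_apply, inner_sub_right, inner_smul_right, real_inner_self_eq_norm_sq]
  by_cases hv : v = 0
  · subst hv
    simp
  · have h : ‖v‖ ^ 2 ≠ 0 := pow_ne_zero 2 (norm_ne_zero_iff.2 hv)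
    field_simp
    ring

/-- `P_v` is idempotent: `P_v (P_v a) = P_v a`. [folklore] -/
theorem radialProj_radialProj (v a : V) : radialProj v (radialProj v a) = radialProj v a :=
  radialProj_apply_of_inner_eq_zero (inner_radialProj v a)

/-! ### The Gauss identities -/

/-- **Radial lines have unit speed**: `polarBilin K v (v, v) = ‖v‖²` (`v ≠ 0`), for every
tangential part `K`. [cite: LeeRiemannianManifolds2018, Thm. 6.9] -/
theorem polarBilin_apply_self_self (K : V → V →L[ℝ] V →L[ℝ] ℝ) {v : V} (hv : v ≠ 0) :
    polarBilin K v v v = ‖v‖ ^ 2 := by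
  rw [polarBilin_apply, radialProj_apply_self hv, map_zero, add_zero, real_inner_self_eq_norm_sq]
  have h : ‖v‖ ^ 2 ≠ 0 := pow_ne_zero 2 (norm_ne_zero_iff.2 hv)
  field_simp

/-- **Radial lines are orthogonal to the spheres**: `polarBilin K v (v, β) = 0` for `β ⊥ v`,
`v ≠ 0`. [cite: LeeRiemannianManifolds2018, Thm. 6.9] -/
theorem polarBilin_apply_self_of_inner_eq_zero (K : V → V →L[ℝ] V →L[ℝ] ℝ) {v β : V} (hv : v ≠ 0)
    (h : ⟪v, β⟫ = 0) : polarBilin K v v β = 0 := by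
  rw [polarBilin_apply, radialProj_apply_self hv, map_zero, h]
  simp

/-- The symmetric companion: `polarBilin K v (β, v) = 0` for `β ⊥ v`, `v ≠ 0`. [folklore] -/
theorem polarBilin_apply_of_inner_eq_zero_self (K : V → V →L[ℝ] V →L[ℝ] ℝ) {v β : V} (hv : v ≠ 0)
    (h : ⟪v, β⟫ = 0) : polarBilin K v β v = 0 := by
  rw [polarBilin_apply, radialProj_apply_self hv, map_zero, h]
  simp

/-! ### Symmetry and positivity -/

/-- The polar field is symmetric when its tangential part is. [folklore] -/
theorem polarBilin_symm (K : V → V →L[ℝ] V →L[ℝ] ℝ) {v : V} (hK : ∀ a b : V, K v a b = K v b a)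
    (a b : V) : polarBilin K v a b = polarBilin K v b a := by
  rw [polarBilin_apply, polarBilin_apply, hK, mul_comm ⟪v, a⟫]

/-- **The polar field is positive definite when its tangential part is** (on all of `V`; only the
values on `v^⊥` matter). Indeed for `a ≠ 0` either `P_v a ≠ 0`, and then the tangential term is
positive and the radial one nonnegative, or `P_v a = 0`, and then `a` is a nonzero multiple of `v`
and the radial term is `⟪v,a⟫²/‖v‖² > 0`. [folklore] -/
theorem polarBilin_pos (K : V → V →L[ℝ] V →L[ℝ] ℝ) {v : V} (hK : ∀ a : V, a ≠ 0 → 0 < K v a a)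
    {a : V} (ha : a ≠ 0) : 0 < polarBilin K v a a := by
  rw [polarBilin_apply]
  have hrad : 0 ≤ (‖v‖ ^ 2)⁻¹ * (⟪v, a⟫ * ⟪v, a⟫) :=
    mul_nonneg (inv_nonneg.2 (sq_nonneg _)) (mul_self_nonneg _)
  by_cases hP : radialProj v a = 0
  · -- `a` is radial: `a = (⟪v,a⟫/‖v‖²) v` with `⟪v, a⟫ ≠ 0`
    rw [hP, map_zero, add_zero]
    have ha' : a = ((‖v‖ ^ 2)⁻¹ * ⟪v, a⟫) • v := by
      have h := hP
      rw [radialProj_apply, sub_eq_zero] at h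
      exact h
    have hva : ⟪v, a⟫ ≠ 0 := by
      intro h0
      rw [h0, mul_zero, zero_smul] at ha'
      exact ha ha'
    have hv : v ≠ 0 := by
      intro h0
      rw [h0, inner_zero_left] at hva
      exact hva rfl
    have hvn : 0 < ‖v‖ ^ 2 := by positivity
    exact mul_pos (inv_pos.2 hvn) (mul_self_pos.2 hva)
  · exact add_pos_of_nonneg_of_pos hrad (hK _ hP)

/-! ### Agreement lemmas: radial forms, the inner product -/

/-- **A form which is already radial at `v` is its own polar field there**: if `B(v, v) = ‖v‖²`
and `B(v, β) = B(β, v) = 0` for all `β ⊥ v` (`v ≠ 0`), then `polarBilin K v = B` for every `K` with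
`K v = B`. (Expand `a = P_v a + (⟪v,a⟫/‖v‖²) v`, `b` likewise, by bilinearity.) This is how the
construction glues: where the pulled-back ambient metric is radial, prescribing it as tangential
part reproduces it exactly. [folklore] -/
theorem polarBilin_eq_of_isRadialAt (K : V → V →L[ℝ] V →L[ℝ] ℝ) {v : V} (hv : v ≠ 0)
    {B : V →L[ℝ] V →L[ℝ] ℝ} (hKB : K v = B) (hBvv : B v v = ‖v‖ ^ 2)
    (hBv : ∀ β : V, ⟪v, β⟫ = 0 → B v β = 0) (hBv' : ∀ β : V, ⟪v, β⟫ = 0 → B β v = 0) :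
    polarBilin K v = B := by
  have h2 : ‖v‖ ^ 2 ≠ 0 := pow_ne_zero 2 (norm_ne_zero_iff.2 hv)
  ext a b
  rw [polarBilin_apply, hKB]
  -- decompose `a` and `b`
  set α : ℝ := (‖v‖ ^ 2)⁻¹ * ⟪v, a⟫ with hα
  set β' : ℝ := (‖v‖ ^ 2)⁻¹ * ⟪v, b⟫ with hβ'
  have ha : a = radialProj v a + α • v := by rw [radialProj_apply]; abel
  have hb : b = radialProj v b + β' • v := by rw [radialProj_apply]; abel
  have hPa : ⟪v, radialProj v a⟫ = 0 := inner_radialProj v a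
  have hPb : ⟪v, radialProj v b⟫ = 0 := inner_radialProj v b
  conv_rhs => rw [ha, hb]
  simp only [map_add, map_smul, add_apply, FunLike.coe_smul,
    Pi.smul_apply, smul_eq_mul, hBv _ hPb, hBv' _ hPa, hBvv, mul_zero, add_zero, zero_add]
  rw [hα, hβ']
  field_simp
  ring

/-- The inner product (as the bilinear form `innerSL`) is radial at every `v`, so **with the inner
product as tangential part the polar field is the inner product** — at every `v`, including
`v = 0` (conventions `0⁻¹ = 0`, `P_0 = id`). [folklore] -/
theorem polarBilin_const_innerSL (K : V → V →L[ℝ] V →L[ℝ] ℝ) {v : V}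
    (hK : K v = (innerSL ℝ : V →L[ℝ] V →L[ℝ] ℝ)) : polarBilin K v = innerSL ℝ := by
  by_cases hv : v = 0
  · subst hv
    ext a b
    rw [polarBilin_apply, hK]
    simp
  · refine polarBilin_eq_of_isRadialAt K hv hK ?_ (fun β hβ ↦ ?_) fun β hβ ↦ ?_
    · rw [innerSL_apply_apply, real_inner_self_eq_norm_sq]
    · rw [innerSL_apply_apply, hβ]
    · rw [innerSL_apply_apply, real_inner_comm, hβ]

/-! ### Smoothness (finite-dimensional `V`: a field of forms is `C^n` iff its matrix entries are) -/

section Smooth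

variable [FiniteDimensional ℝ V]

omit [FiniteDimensional ℝ V] in
/-- `v ↦ P_v c` is `C^∞` on `V ∖ {0}` for every fixed `c`. [folklore] -/
theorem contDiffOn_radialProj_apply {n : WithTop ℕ∞} (c : V) :
    ContDiffOn ℝ n (fun v : V ↦ radialProj v c) {v | v ≠ 0} := by
  have h3 : ContDiffOn ℝ n (fun v : V ↦ (‖v‖ ^ 2)⁻¹) {v | v ≠ 0} := by
    refine (contDiff_norm_sq ℝ (n := n)).contDiffOn.inv fun v hv ↦ ?_
    exact pow_ne_zero 2 (norm_ne_zero_iff.2 hv)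
  have h4 : ContDiffOn ℝ n (fun v : V ↦ ⟪v, c⟫) {v | v ≠ 0} := contDiffOn_id.inner ℝ contDiffOn_const
  have h5 : ContDiffOn ℝ n (fun v : V ↦ ((‖v‖ ^ 2)⁻¹ * ⟪v, c⟫) • v) {v | v ≠ 0} :=
    (h3.mul h4).smul contDiffOn_id
  have h6 : ContDiffOn ℝ n (fun v : V ↦ c - ((‖v‖ ^ 2)⁻¹ * ⟪v, c⟫) • v) {v | v ≠ 0} :=
    contDiffOn_const.sub h5
  refine h6.congr fun v _ ↦ ?_
  exact radialProj_apply v c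

/-- **The polar field is `C^n` away from `0` when its tangential part is** (`V` finite-dimensional,
so that smoothness of a field of bilinear forms is smoothness of all its values
`v ↦ polarBilin K v (a, b)`, `contDiffOn_clm_apply`). [folklore] -/
theorem contDiffOn_polarBilin {n : WithTop ℕ∞} {K : V → V →L[ℝ] V →L[ℝ] ℝ}
    (hK : ContDiffOn ℝ n K {v | v ≠ 0}) : ContDiffOn ℝ n (polarBilin K) {v | v ≠ 0} := by
  rw [contDiffOn_clm_apply]
  intro a
  rw [contDiffOn_clm_apply]
  intro b
  have h3 : ContDiffOn ℝ n (fun v : V ↦ (‖v‖ ^ 2)⁻¹) {v | v ≠ 0} := by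
    refine (contDiff_norm_sq ℝ (n := n)).contDiffOn.inv fun v hv ↦ ?_
    exact pow_ne_zero 2 (norm_ne_zero_iff.2 hv)
  have ha : ContDiffOn ℝ n (fun v : V ↦ ⟪v, a⟫) {v | v ≠ 0} := contDiffOn_id.inner ℝ contDiffOn_const
  have hb : ContDiffOn ℝ n (fun v : V ↦ ⟪v, b⟫) {v | v ≠ 0} := contDiffOn_id.inner ℝ contDiffOn_const
  have hrad : ContDiffOn ℝ n (fun v : V ↦ (‖v‖ ^ 2)⁻¹ * (⟪v, a⟫ * ⟪v, b⟫)) {v | v ≠ 0} :=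
    h3.mul (ha.mul hb)
  have htan : ContDiffOn ℝ n (fun v : V ↦ K v (radialProj v a) (radialProj v b)) {v | v ≠ 0} :=
    (hK.clm_apply (contDiffOn_radialProj_apply a)).clm_apply (contDiffOn_radialProj_apply b)
  refine (hrad.add htan).congr fun v _ ↦ ?_
  exact polarBilin_apply K v a b

/-- **Smoothness everywhere when the tangential part is the inner product near the centre**: if
`K` is `C^n` on `V ∖ {0}` and `K v = ⟪·,·⟫` for all `v` in a neighbourhood of `0`, then `polarBilin K`
is `C^n` on all of `V` (it is constant, equal to the inner product, near `0`:
`polarBilin_const_innerSL`). [folklore] -/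
theorem contDiff_polarBilin_of_eventuallyEq {n : WithTop ℕ∞} {K : V → V →L[ℝ] V →L[ℝ] ℝ}
    (hK : ContDiffOn ℝ n K {v | v ≠ 0})
    (h0 : ∀ᶠ v in 𝓝 (0 : V), K v = (innerSL ℝ : V →L[ℝ] V →L[ℝ] ℝ)) :
    ContDiff ℝ n (polarBilin K) := by
  rw [contDiff_iff_contDiffAt]
  intro v
  by_cases hv : v = 0
  · subst hv
    have hev : polarBilin K =ᶠ[𝓝 (0 : V)] fun _ ↦ (innerSL ℝ : V →L[ℝ] V →L[ℝ] ℝ) := by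
      filter_upwards [h0] with w hw
      exact polarBilin_const_innerSL K hw
    exact contDiffAt_const.congr_of_eventuallyEq hev
  · exact (contDiffOn_polarBilin hK).contDiffAt (isOpen_ne.mem_nhds hv)

end Smooth

end Literature.Geometry.Riemannian

end
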